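/-
Copyright: the b2b-balaban T⁴-continuum CRUX team, row NE7b leaf lineage `t4-ne7b-formalise-leaf-02` (gen 136). Project licence.
-/
import Summits.QuantumFields.BalabanUV.T4Continuum.Spine.NE7b.FlatFloorLemma24Vector
import Summits.QuantumFields.BalabanUV.T4Continuum.Spine.NE7b.TorusSquareReindexing

/-!
# THE FLAT FULL-FORM FLOOR ON THE TWO-SCALE TORUS: [B6] Lemma 2.4 on the torus (`…FlatFloorLemma24Vector.lemma24_torus_vector`, the
# `ℤ^d`-PERIODIC carrier `bondsT ∕ plaqT ∕ faces` of `B6Lemma24Torus`, printed constant `1∕(12d²)`) READ ON THE `ZMod`-TORUS INSTANCE of the (h2) slot: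
# for every bond field `B : (ℤ∕nM)^d × Fin d → W` (`W` a finite-dimensional real inner-product space) in the tree gauge on every `n`-block,
# `(1∕(12d²))·n^{−(d+1)}·Σ_c‖B c‖² ≤ n^{d−2}·Σ_j‖n^{−(d+1)}•Σ_{(r,t)}B(ιA j (r,t))‖² + Σ_P‖B(ι P 0) + B(ι P 1) − B(ι P 2) − B(ι P 3)‖²` with
# `…TorusPlaquetteIncidence`'s `ι` and `…TorusAverageIncidence`'s `ιA` character for character — the (h2) floor AT `U = 1` with NO IMS loss, and the
# per-cube (flat) letter of the `U ≠ 1` road (row NE7b, node U5c; residual (R2′) family (2), letter (ℓ1); E-side junction lemmas, lattice geometry)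

Cell `pub-balaban`, sub-cell `t4`, spine estimate NE7b (`T4WeightBudget.RelWeightBound`; the cell's OWN estimate — NOT PRINTED in [Bałaban 1983–89],
NOT PROVED).  Crux-route work under `Spine/NE7b/` by a row leaf (`t4-ne7b-formalise-leaf-02`, E-side ∕ key-readings ∕ lattice-geometry lineage, gen 136)
under FREEZE (0)'s crux-prover clause; [folklore] re-indexing over a PROVED Literature theorem; NOTHING of Bałaban's is asserted beyond what the cited
modules prove; no `def` (the periodic lift of a torus field is the lambda `fun bd => B (tcls N bd.1, bd.2)`, the incidences `ι`, `ιA` are carried by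
their characterising hypotheses `hι`, `hιA` as in TPI ∕ TAI); zero `sorry`; no `T4Continuum/Support` leaf.
Imports: leaf-05's `…FlatFloorLemma24Vector` (`lemma24_torus_vector` — [B6] CMP **96** (1984) Lemma 2.4 (2.128) p. 245 in the scope of p. 249, «on the
whole lattice `T^{(k)}`», for `W`-valued fields, PROVED; through it `B6Lemma24Torus` (`pbox`, `coarseSites`, `faces`, `bondsT`, `plaqT`, `IsPeriod`),
`B6BondElimination` (`unitVec`, `treeBonds`), `B6Elimination.block`) and this lineage's `…TorusSquareReindexing` (`tcls_add_natMul_e`,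
`tcls_blockBase_add_boxVec`; through it `T4TermwiseTorus` (`tcls`, `tlift`, `box`) and `B7Prop1Explicit` (`e`, `boxVec`)).

WHY.  Two tree files name this junction as this lineage's: leaf-05 g158's `…FlatFloorLemma24Vector` («NOT HERE: the transport to the torus cube of the
k = 1 instance … leaf-02 ∕ OWNER») and `…AdmissibleFloorLetters` ∕ `…AdmissibleFloorFlatComponents` («the identification of `q1Of`∕`d1Sq` with
scalar-coefficient terms on the instance's `inc` (leaf-02)»).  The (h2) instance of this lineage (`…FullFormSineFloor(Sq)`, `…CurlTermsLinear`,
`…AverageTermsLinear`, `…AverageTermsPrinted`) lives on the `ZMod`-torus `(Fin d → ZMod (n·M)) × Fin d` with the plaquette terms indexed by TPI's `ι`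
and the block averages by TAI's `ιA`; the PROVED flat floor lives on `ℤ^d`-periodic fields indexed by the fundamental box.  THIS FILE is the dictionary,
and draws the two consequences the (h2) slot wants: (a) AT `U = 1` (all transports `1`) the full form `n^{d−2}Σ_j Y_j(B)² + Σ_P X_P(B)²` is bounded below
by `(1∕(12d²))·n^{−(d+1)}·Σ_c‖B c‖²` for EVERY field in the tree gauge — the (h2) floor DIRECTLY, with print's constant, no localisation error and no
condition on the number of cubes (at `U = 1` B9 Sect. E's «Lemma 2.4′» IS Lemma 2.4 on the torus, p. 249); (b) for the `U ≠ 1` road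
(`…AdmissibleFloorSeminormTwoFamilies` §3's five per-cube letters) the (flat) letter `∀ Y, good⁰ Y → c·N′ Y ≤ F⁰ Y` is THIS torus floor applied to the
gauged localised field `(h_s•x)^{u_s}` with `good⁰ := tree gauge ∧ (anything)` — no box lift and no wrap-around condition: the IMS localisation of
`SectE-interface-proof.md` §5.6 is needed only to make the local gauge `u_s` small on `supp h_s`, never for the flat floor itself.

WHAT IS PROVED ([folklore]; `N = n·M`, `[NeZero N]`):
* §1 RE-INDEXING THE PERIODIC CARRIER BY THE `ZMod` FINTYPES: `pbox_const_eq_box`; **`sum_pbox_tcls`** (`Σ_{x∈[0,N)^d} f(tcls x) = Σ_{z : (ZMod N)^d} f z`,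
  `tcls`∕`tlift` inverse on the box); **`sum_bondsT_tcls`**; **`sum_plaqT_tcls`** (plaquettes `(x; j<μ)`, `x` in the box ↔ `(ZMod N)^d × {a ∕∕ a.1 < a.2}`);
  `block_eq_image_boxVec` ∕ **`sum_block_boxVec`** (`Σ_{x∈B(y)} f x = Σ_{r : Fin d → Fin n} f(y + r)`); **`sum_faces_eq`** (the torus coarse bonds `(y, κ)`,
  `y ∈ nℤ^d ∩ [0,N)^d` ↔ `(ZMod M)^d × Fin d` through `y = n·val(ȳ)`).
* §2 THE PERIODIC LIFT `X := fun bd => B (tcls N bd.1, bd.2)`: `tcls_add_of_isPeriod` (the lift is `N`-periodic), `tcls_add_unitVec`,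
  `tcls_add_natCast_smul_unitVec`, **`tcls_avgSite`** (the lift reads the fine site `n·val(ȳ) + r + te_κ` at TAI's `(ιA (ȳ,κ) (r,t)).1`).
* §3 **`flat_full_form_floor_torus`** — THE FLOOR: `2 ≤ d`; `B : (Fin d → ZMod (n·M)) × Fin d → W` vanishing on the tree bonds of every block
  (`∀ y ∈ coarseSites n N, ∀ bd ∈ treeBonds n y, B (tcls N bd.1, bd.2) = 0`); TPI's `ι`∕`hι`, TAI's `ιA`∕`hιA` ⊢
  `1∕(12d²)·(n^{d+1})⁻¹·Σ_c‖B c‖² ≤ n^{d−2}·Σ_j‖(n^{d+1})⁻¹ • Σ_{rt} B (ιA j rt)‖² + Σ_P‖B (ι P 0) + B (ι P 1) − B (ι P 2) − B (ι P 3)‖²`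
  (`lemma24_torus_vector` on the lift, then §1–§2; natural-number exponents).
* §4 **`flat_full_form_floor_torus_weighted`** — the same with the level weight INSIDE the square, `Σ_j‖(√(n^{d−2})·(n^{d+1})⁻¹) • Σ_{rt} B (ιA j rt)‖²`
  (the currency of `…FullFormSineFloorPrinted(Sq)` §2, OWNER W-ne7bp1-g114-13: «`ω ↦ n^{(d−2)∕2}·ω` inside»); **`flat_letter_torus`** — §3 packaged as the
  `hflat` binder of AFS2 §3 ∕ AFST §3 on the torus: `∀ Y, (tree gauge ∧ extra Y) → c·Σ_c‖Y c‖² ≤ F⁰ Y` for ANY side predicate `extra` (support in a cube, …).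
* §5 toy: `d = 2`, `n = M = 1`, `W = ℝ²`, `B = 0`, incidences by their lambdas fed by `rfl` (elaboration + the floor `0 ≤ 0`-shaped instance).

NOT HERE (honest): the `U ≠ 1` letters (cov) ∕ (pert) ∕ (iso) BY VALUE (leaf-05 ∕ leaf-06 lanes: AFPT, CCTL ∕ LGTS), the operator-currency reading on
`M_n(ℂ)` (AFFC §4, price `|n|`; Q-leaf05-g157-1 UNRULED), which typed operator the row names `Q₁(V)` ((A3) ∕ OWNER), `k > 1`; anything of Bałaban's beyond
[B6] Lemma 2.4 as PROVED in the tree; (A1c); NC-NE7b-α UNRULED.  BY-NAME EFFECT ON THE WALL: NONE (the (h2) slot's flat letter on the instance; the wall is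
(R2)).  NE7b NOT PRINTED ∕ NOT PROVED; spine PROVED 0∕9; rung (B)+1 on ONE finite T⁴ — NOT infinite volume, NOT the mass gap, NOT Clay.
HONEST DEPENDENCY: continuum YM on T⁴ ⇐ BetaPertH ∧ nine spine estimates (0/9 proved); BetaPertH ⇐ (D1) ∧ (D4) ∧ CAP+tail; G-an2-4 gates asym, D1 and NE2/3/4.
-/

set_option autoImplicit false

noncomputable section

open Finset
open Literature.MathematicalPhysics.QuantumFieldTheory.Balaban1983to89.B7Prop1Explicit (Site e e_apply boxVec)
open Literature.MathematicalPhysics.QuantumFieldTheory.Balaban1983to89.T4TermwiseTorus (tcls tcls_apply tcls_add tlift box mem_box tcls_tlift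
  tlift_mem_box tlift_tcls_of_mem_box boxVec_injective)
open Literature.MathematicalPhysics.QuantumFieldTheory.Balaban1983to89.B6BondElimination (unitVec unitVec_apply treeBonds)
open Literature.MathematicalPhysics.QuantumFieldTheory.Balaban1983to89.B6Elimination (block mem_block)
open Literature.MathematicalPhysics.QuantumFieldTheory.Balaban1983to89.B6Lemma24Torus (IsPeriod pbox mem_pbox coarseSites mem_coarseSites faces
  mem_faces bondsT plaqT mem_plaqT)
open Summit.QuantumFields.BalabanUV.T4Continuum.NE7b.TorusSquareReindexing (tcls_add_natMul_e tcls_blockBase_add_boxVec)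
open Summit.QuantumFields.BalabanUV.T4Continuum.NE7b.FlatFloorLemma24Vector (lemma24_torus_vector)

namespace Summit.QuantumFields.BalabanUV.T4Continuum.NE7b.FlatFullFormFloorTorus

variable {d : ℕ}

/-! ## §1 Re-indexing the periodic carrier by the `ZMod` Fintypes -/

section Reindex

variable (N : ℕ) {β : Type*} [AddCommMonoid β]

/-- The fundamental box of `B6Lemma24Torus` with all periods `N` is `T4TermwiseTorus.box N`. [folklore] -/
theorem pbox_const_eq_box : pbox (fun _ : Fin d => N) = box N := by
  ext x
  rw [mem_pbox, mem_box]

/-- **`Σ_{x ∈ [0,N)^d} f (tcls N x) = Σ_{z : (ZMod N)^d} f z`** — `tcls` and `tlift` are inverse bijections between the box and the torus classes.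
[folklore] -/
theorem sum_pbox_tcls [NeZero N] (f : (Fin d → ZMod N) → β) :
    ∑ x ∈ pbox (fun _ : Fin d => N), f (tcls N x) = ∑ z, f z := by
  refine Finset.sum_nbij' (tcls N) tlift (fun _ _ => mem_univ _) (fun z _ => ?_) (fun x hx => ?_) (fun z _ => tcls_tlift z)
    (fun _ _ => rfl)
  · rw [pbox_const_eq_box]
    exact tlift_mem_box z
  · rw [pbox_const_eq_box] at hx
    exact tlift_tcls_of_mem_box hx

/-- **Torus bonds**: `Σ_{bd ∈ bondsT} g (tcls N bd.1, bd.2) = Σ_{c : (ZMod N)^d × Fin d} g c`. [folklore] -/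
theorem sum_bondsT_tcls [NeZero N] (g : (Fin d → ZMod N) × Fin d → β) :
    ∑ bd ∈ bondsT (fun _ : Fin d => N), g (tcls N bd.1, bd.2) = ∑ c, g c := by
  rw [bondsT, Finset.sum_product, Fintype.sum_prod_type]
  exact sum_pbox_tcls N fun z => ∑ ν, g (z, ν)

/-- **Torus plaquettes**: `Σ_{p ∈ plaqT} g (tcls N p.1) j μ` (lowest corner in the box, directions `j < μ`) `= Σ_{P : (ZMod N)^d × {a ∕∕ a.1 < a.2}} g P.1 a.1 a.2`.
[folklore] -/
theorem sum_plaqT_tcls [NeZero N] (g : (Fin d → ZMod N) → Fin d → Fin d → β) :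
    ∑ p ∈ plaqT (fun _ : Fin d => N), g (tcls N p.1) p.2.1 p.2.2
      = ∑ P : (Fin d → ZMod N) × {a : Fin d × Fin d // a.1 < a.2}, g P.1 P.2.1.1 P.2.1.2 := by
  refine Finset.sum_bij' (fun p hp => (tcls N p.1, ⟨p.2, (mem_plaqT.1 hp).2⟩)) (fun P _ => (tlift P.1, P.2.1))
    (fun _ _ => mem_univ _) (fun P _ => ?_) (fun p hp => ?_) (fun P _ => ?_) (fun _ _ => rfl)
  · rw [mem_plaqT, pbox_const_eq_box]
    exact ⟨tlift_mem_box P.1, P.2.2⟩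
  · have h1 : p.1 ∈ box N := by rw [← pbox_const_eq_box]; exact (mem_plaqT.1 hp).1
    exact Prod.ext (tlift_tcls_of_mem_box h1) rfl
  · exact Prod.ext (tcls_tlift P.1) rfl

end Reindex

section Blocks

variable (n : ℕ) {β : Type*} [AddCommMonoid β]

/-- A block is parametrised by its offsets: `B(y) = {y + r : r ∈ [0,n)^d}`. [folklore] -/
theorem block_eq_image_boxVec (y : Fin d → ℤ) :
    block n y = (univ : Finset (Fin d → Fin n)).image fun r => y + boxVec n r := by
  ext x
  simp only [mem_block, mem_image, mem_univ, true_and]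
  constructor
  · intro h
    refine ⟨fun i => ⟨(x i - y i).toNat, by have := h i; omega⟩, funext fun i => ?_⟩
    have := h i
    simp only [Pi.add_apply, boxVec]
    omega
  · rintro ⟨r, rfl⟩ i
    have := (r i).isLt
    simp only [Pi.add_apply, boxVec]
    omega

/-- **`Σ_{x ∈ B(y)} f x = Σ_{r : Fin d → Fin n} f (y + r)`**. [folklore] -/
theorem sum_block_boxVec (y : Fin d → ℤ) (f : (Fin d → ℤ) → β) :
    ∑ x ∈ block n y, f x = ∑ r : Fin d → Fin n, f (y + boxVec n r) := by
  rw [block_eq_image_boxVec, sum_image fun r _ r' _ h => boxVec_injective n (add_left_cancel h)]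

/-- **The torus coarse bonds by the coarse `ZMod` torus**: `Σ_{c ∈ faces n (N…N)} g c = Σ_{j : (ZMod M)^d × Fin d} g (n·val(j.1), j.2)` (`N = n·M`):
`ȳ ↦ (n·val(ȳ_i))_i` is a bijection from `(ZMod M)^d` onto `nℤ^d ∩ [0,N)^d`. [folklore] -/
theorem sum_faces_eq {M : ℕ} [NeZero M] (hn : 0 < n) (g : (Fin d → ℤ) × Fin d → β) :
    ∑ c ∈ faces n (fun _ : Fin d => n * M), g c
      = ∑ j : (Fin d → ZMod M) × Fin d, g ((fun i => (n : ℤ) * ((j.1 i).val : ℤ)), j.2) := by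
  symm
  refine Finset.sum_nbij' (fun j => ((fun i => (n : ℤ) * ((j.1 i).val : ℤ)), j.2))
    (fun c => ((fun i => (((c.1 i / (n : ℤ)).toNat : ℕ) : ZMod M)), c.2)) (fun j _ => ?_) (fun _ _ => mem_univ _)
    (fun j _ => ?_) (fun c hc => ?_) (fun _ _ => rfl)
  · -- into the torus coarse bonds
    rw [mem_faces, mem_coarseSites, mem_pbox]
    refine ⟨fun i => ⟨by positivity, ?_⟩, fun i => ⟨((j.1 i).val : ℤ), rfl⟩⟩
    have h1 : ((j.1 i).val : ℤ) < M := by exact_mod_cast ZMod.val_lt (j.1 i)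
    have h2 : (0 : ℤ) < n := by exact_mod_cast hn
    push_cast
    nlinarith
  · -- left inverse on the coarse torus
    obtain ⟨y, κ⟩ := j
    refine Prod.ext (funext fun i => ?_) rfl
    have hn' : (n : ℤ) ≠ 0 := by exact_mod_cast hn.ne'
    simp only [Int.mul_ediv_cancel_left _ hn', Int.toNat_natCast, ZMod.natCast_zmod_val]
  · -- right inverse on the torus coarse bonds
    obtain ⟨y, κ⟩ := c
    obtain ⟨hy, hdvd⟩ := mem_coarseSites.1 (mem_faces.1 hc)
    refine Prod.ext (funext fun i => ?_) rfl
    obtain ⟨q, hq⟩ := hdvd i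
    obtain ⟨h0, hlt⟩ := (mem_pbox.1 hy) i
    have hn' : (0 : ℤ) < n := by exact_mod_cast hn
    rw [hq] at h0 hlt
    have hq0 : 0 ≤ q := by nlinarith
    have hqM : q < M := by push_cast at hlt; nlinarith
    have hqn : q.toNat < M := by omega
    have hq' : y i = (n : ℤ) * q := hq
    dsimp only
    rw [hq', Int.mul_ediv_cancel_left _ hn'.ne', ZMod.val_natCast_of_lt hqn, Int.toNat_of_nonneg hq0]

end Blocks

/-! ## §2 The periodic lift of a `ZMod`-torus field to `ℤ^d` -/

section Lift

variable (N : ℕ)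

/-- A period of the torus is killed by `tcls`: `tcls N (x + v) = tcls N x` for `v ∈ Nℤ^d`. [folklore] -/
theorem tcls_add_of_isPeriod {v : Fin d → ℤ} (hv : IsPeriod (fun _ : Fin d => N) v) (x : Fin d → ℤ) :
    tcls N (x + v) = tcls N x := by
  funext i
  rw [tcls_add, Pi.add_apply, tcls_apply N v, (ZMod.intCast_zmod_eq_zero_iff_dvd (v i) N).2 (hv i), add_zero]

/-- `tcls N (x + e_j) = tcls N x + δ_j` (`B6BondElimination.unitVec j` is `B7Prop1Explicit.e j` — inlined; the named twin of that one-liner is the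
β-team's `Beta.EriceCurvatureFormReflection.unitVec_eq_e`, not imported here to keep the closure inside the NE7b column). [folklore] -/
theorem tcls_add_unitVec (x : Fin d → ℤ) (j : Fin d) : tcls N (x + unitVec j) = tcls N x + Pi.single j 1 := by
  have hue : unitVec j = e j := funext fun i => by rw [unitVec_apply, e_apply]
  have h := tcls_add_natMul_e N x j 1
  rwa [Nat.cast_one, Nat.cast_one, one_smul, ← hue] at h

/-- `tcls N (x + s•e_μ) = tcls N x + s·δ_μ` (`s : ℕ`). [folklore] -/
theorem tcls_add_natCast_smul_unitVec (x : Fin d → ℤ) (μ : Fin d) (s : ℕ) :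
    tcls N (x + (s : ℤ) • unitVec μ) = tcls N x + Pi.single μ ((s : ℕ) : ZMod N) := by
  have hue : unitVec μ = e μ := funext fun i => by rw [unitVec_apply, e_apply]
  rw [hue, tcls_add_natMul_e]

/-- **THE LIFT READS THE AVERAGE TERM's SITES AT TAI's INCIDENCE**: the class of the fine site `n·val(ȳ) + r + te_κ` is
`(val(ȳ_i)·n + r_i)_i + t·δ_κ` on `(ℤ∕nM)^d`. [folklore] -/
theorem tcls_avgSite (n : ℕ) {M : ℕ} (y : Fin d → ZMod M) (κ : Fin d) (r : Fin d → Fin n) (t : ℕ) :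
    tcls (n * M) ((fun i => (n : ℤ) * ((y i).val : ℤ)) + boxVec n r + (t : ℤ) • unitVec κ)
      = (fun i => ((((y i).val * n + (r i : ℕ) : ℕ)) : ZMod (n * M))) + Pi.single κ ((t : ℕ) : ZMod (n * M)) := by
  rw [tcls_add_natCast_smul_unitVec, tcls_blockBase_add_boxVec]

end Lift

/-! ## §3 The flat full-form floor on the `ZMod` torus -/

section Floor

variable {W : Type*} [NormedAddCommGroup W] [InnerProductSpace ℝ W] [FiniteDimensional ℝ W]

/-- **THE FLAT FULL-FORM FLOOR ON THE TWO-SCALE TORUS** ([B6] Lemma 2.4 on the torus, PROVED, read on the `ZMod`-torus instance): `2 ≤ d`, block side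
`n ≥ 1`, `M ≥ 1` blocks per axis; a bond field `B : (ℤ∕nM)^d × Fin d → W` in the tree gauge on every block (`B = 0` on the lift's tree bonds
`treeBonds n y`, `y ∈ nℤ^d ∩ [0,nM)^d`); TPI's plaquette incidence `ι` (`hι`) and TAI's average incidence `ιA` (`hιA`) ⊢
`(1∕(12d²))·(n^{d+1})⁻¹·Σ_c‖B c‖² ≤ n^{d−2}·Σ_j‖(n^{d+1})⁻¹ • Σ_{(r,t)} B(ιA j (r,t))‖² + Σ_P‖B(ι P 0) + B(ι P 1) − B(ι P 2) − B(ι P 3)‖²` —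
the (h2) floor at `U = 1`, print's constant, no localisation. [folklore] -/
theorem flat_full_form_floor_torus (hd : 2 ≤ d) (n M : ℕ) [NeZero n] [NeZero M] [NeZero (n * M)]
    (ι : (Fin d → ZMod (n * M)) × {a : Fin d × Fin d // a.1 < a.2} → Fin 4 → (Fin d → ZMod (n * M)) × Fin d)
    (hι : ∀ x a, ι (x, a) = ![(x, a.1.1), (x + Pi.single a.1.1 1, a.1.2), (x + Pi.single a.1.2 1, a.1.1), (x, a.1.2)])
    (ιA : (Fin d → ZMod M) × Fin d → (Fin d → Fin n) × Fin n → (Fin d → ZMod (n * M)) × Fin d)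
    (hιA : ∀ y κ r t, ιA (y, κ) (r, t) =
      ((fun i => (((y i).val * n + (r i : ℕ) : ℕ) : ZMod (n * M))) + Pi.single κ ((t : ℕ) : ZMod (n * M)), κ))
    (B : (Fin d → ZMod (n * M)) × Fin d → W)
    (hT : ∀ y ∈ coarseSites n (fun _ : Fin d => n * M), ∀ bd ∈ treeBonds n y, B (tcls (n * M) bd.1, bd.2) = 0) :
    1 / (12 * (d : ℝ) ^ 2) * ((n : ℝ) ^ (d + 1))⁻¹ * ∑ c, ‖B c‖ ^ 2 ≤
      (n : ℝ) ^ (d - 2) * ∑ j, ‖((n : ℝ) ^ (d + 1))⁻¹ • ∑ rt, B (ιA j rt)‖ ^ 2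
        + ∑ P, ‖B (ι P 0) + B (ι P 1) - B (ι P 2) - B (ι P 3)‖ ^ 2 := by
  classical
  have hn : 0 < n := Nat.pos_of_ne_zero (NeZero.ne n)
  have hN : 0 < n * M := Nat.pos_of_ne_zero (NeZero.ne _)
  -- [B6] Lemma 2.4 on the torus for the periodic lift
  have key := lemma24_torus_vector (W := W) hd hn (M := fun _ : Fin d => n * M) (fun _ => hN) (fun _ => Dvd.intro M rfl)
    (fun bd : (Fin d → ℤ) × Fin d => B (tcls (n * M) bd.1, bd.2))
    (fun x v ν hv => by simp only [tcls_add_of_isPeriod (n * M) hv]) hT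
  -- exponents as natural powers
  have e1 : (n : ℝ) ^ (-((d : ℝ) + 1)) = ((n : ℝ) ^ (d + 1))⁻¹ := by
    rw [Real.rpow_neg (Nat.cast_nonneg _), ← Nat.cast_succ, Real.rpow_natCast]
  have e2 : (n : ℝ) ^ ((d : ℝ) - 2) = (n : ℝ) ^ (d - 2) := by
    rw [show ((d : ℝ) - 2) = ((d - 2 : ℕ) : ℝ) by rw [Nat.cast_sub hd]; norm_num, Real.rpow_natCast]
  rw [e1, e2] at key
  -- ‖B‖² on the torus
  have eN : ∑ bd ∈ bondsT (fun _ : Fin d => n * M), ‖B (tcls (n * M) bd.1, bd.2)‖ ^ 2 = ∑ c, ‖B c‖ ^ 2 :=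
    sum_bondsT_tcls (n * M) fun c => ‖B c‖ ^ 2
  -- the plaquette terms
  have eP : ∑ p ∈ plaqT (fun _ : Fin d => n * M),
      ‖B (tcls (n * M) (p.1, p.2.1).1, (p.1, p.2.1).2) + B (tcls (n * M) (p.1 + unitVec p.2.1, p.2.2).1, (p.1 + unitVec p.2.1, p.2.2).2)
        - B (tcls (n * M) (p.1 + unitVec p.2.2, p.2.1).1, (p.1 + unitVec p.2.2, p.2.1).2) - B (tcls (n * M) (p.1, p.2.2).1, (p.1, p.2.2).2)‖ ^ 2
      = ∑ P, ‖B (ι P 0) + B (ι P 1) - B (ι P 2) - B (ι P 3)‖ ^ 2 := by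
    refine Eq.trans (Finset.sum_congr rfl fun p _ => ?_) ((sum_plaqT_tcls (n * M) fun z j μ =>
      ‖B (z, j) + B (z + Pi.single j 1, μ) - B (z + Pi.single μ 1, j) - B (z, μ)‖ ^ 2).trans
        (Finset.sum_congr rfl fun P _ => ?_))
    · simp only [tcls_add_unitVec]
    · obtain ⟨x, a⟩ := P
      rw [hι]
      rfl
  -- the average terms
  have eA : ∑ c ∈ faces n (fun _ : Fin d => n * M),
      ‖∑ x ∈ block n c.1, (((n : ℝ) ^ (d + 1))⁻¹) •
        ∑ s ∈ range n, B (tcls (n * M) (x + (s : ℤ) • unitVec c.2, c.2).1, (x + (s : ℤ) • unitVec c.2, c.2).2)‖ ^ 2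
      = ∑ j, ‖((n : ℝ) ^ (d + 1))⁻¹ • ∑ rt, B (ιA j rt)‖ ^ 2 := by
    rw [sum_faces_eq n hn]
    refine Finset.sum_congr rfl fun j _ => ?_
    obtain ⟨y, κ⟩ := j
    dsimp only
    rw [sum_block_boxVec, ← Finset.smul_sum, Fintype.sum_prod_type]
    congr 2
    refine congrArg _ (Finset.sum_congr rfl fun r _ => ?_)
    rw [Finset.sum_range]
    refine Finset.sum_congr rfl fun t _ => ?_
    rw [hιA, tcls_avgSite]
  rw [eN, eP, eA] at key
  exact key

/-! ## §4 The weighted currency, and the (flat) binder shape -/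

omit [FiniteDimensional ℝ W] in
/-- the level weight moved inside the square: `n^{d−2}·‖ω • v‖² = ‖(√(n^{d−2})·ω) • v‖²`. [folklore] -/
theorem weight_inside_sq (n : ℕ) (ω : ℝ) (v : W) :
    (n : ℝ) ^ (d - 2) * ‖ω • v‖ ^ 2 = ‖(Real.sqrt ((n : ℝ) ^ (d - 2)) * ω) • v‖ ^ 2 := by
  have h0 : 0 ≤ (n : ℝ) ^ (d - 2) := by positivity
  rw [mul_smul, norm_smul (Real.sqrt ((n : ℝ) ^ (d - 2))) (ω • v), Real.norm_eq_abs, abs_of_nonneg (Real.sqrt_nonneg _), mul_pow,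
    Real.sq_sqrt h0]

/-- **THE FLOOR IN THE WEIGHTED CURRENCY** (`…FullFormSineFloorPrinted(Sq)` §2: weight `√(n^{d−2})·n^{−(d+1)}` INSIDE the average functional):
`(1∕(12d²))·(n^{d+1})⁻¹·Σ_c‖B c‖² ≤ Σ_j‖(√(n^{d−2})·(n^{d+1})⁻¹) • Σ_{rt} B(ιA j rt)‖² + Σ_P‖B(ι P 0) + B(ι P 1) − B(ι P 2) − B(ι P 3)‖²`. [folklore] -/
theorem flat_full_form_floor_torus_weighted (hd : 2 ≤ d) (n M : ℕ) [NeZero n] [NeZero M] [NeZero (n * M)]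
    (ι : (Fin d → ZMod (n * M)) × {a : Fin d × Fin d // a.1 < a.2} → Fin 4 → (Fin d → ZMod (n * M)) × Fin d)
    (hι : ∀ x a, ι (x, a) = ![(x, a.1.1), (x + Pi.single a.1.1 1, a.1.2), (x + Pi.single a.1.2 1, a.1.1), (x, a.1.2)])
    (ιA : (Fin d → ZMod M) × Fin d → (Fin d → Fin n) × Fin n → (Fin d → ZMod (n * M)) × Fin d)
    (hιA : ∀ y κ r t, ιA (y, κ) (r, t) =
      ((fun i => (((y i).val * n + (r i : ℕ) : ℕ) : ZMod (n * M))) + Pi.single κ ((t : ℕ) : ZMod (n * M)), κ))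
    (B : (Fin d → ZMod (n * M)) × Fin d → W)
    (hT : ∀ y ∈ coarseSites n (fun _ : Fin d => n * M), ∀ bd ∈ treeBonds n y, B (tcls (n * M) bd.1, bd.2) = 0) :
    1 / (12 * (d : ℝ) ^ 2) * ((n : ℝ) ^ (d + 1))⁻¹ * ∑ c, ‖B c‖ ^ 2 ≤
      ∑ j, ‖(Real.sqrt ((n : ℝ) ^ (d - 2)) * ((n : ℝ) ^ (d + 1))⁻¹) • ∑ rt, B (ιA j rt)‖ ^ 2
        + ∑ P, ‖B (ι P 0) + B (ι P 1) - B (ι P 2) - B (ι P 3)‖ ^ 2 := by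
  refine (flat_full_form_floor_torus hd n M ι hι ιA hιA B hT).trans (le_of_eq ?_)
  congr 1
  rw [Finset.mul_sum]
  exact Finset.sum_congr rfl fun j _ => weight_inside_sq n _ _

/-- **THE (flat) BINDER ON THE TORUS** — §3 packaged as the `hflat` hypothesis of `…AdmissibleFloorSeminormTwoFamilies` §3 ∕ `…AdmissibleFloorSeminormTerms`
§3 ∕ `…AdmissibleFloorIMS` §4: `∀ Y, good⁰ Y → c·N′ Y ≤ F⁰ Y` with `good⁰ Y := (tree gauge of Y) ∧ extra Y` for ANY side predicate `extra` (e.g. «supported in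
the cube's bonds» — not needed by the flat floor, only by the (pert) letter), `N′ Y := Σ_c‖Y c‖²` over the whole torus, `F⁰ :=` the flat full form,
`c := (1∕(12d²))·(n^{d+1})⁻¹`. [folklore] -/
theorem flat_letter_torus (hd : 2 ≤ d) (n M : ℕ) [NeZero n] [NeZero M] [NeZero (n * M)]
    (ι : (Fin d → ZMod (n * M)) × {a : Fin d × Fin d // a.1 < a.2} → Fin 4 → (Fin d → ZMod (n * M)) × Fin d)
    (hι : ∀ x a, ι (x, a) = ![(x, a.1.1), (x + Pi.single a.1.1 1, a.1.2), (x + Pi.single a.1.2 1, a.1.1), (x, a.1.2)])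
    (ιA : (Fin d → ZMod M) × Fin d → (Fin d → Fin n) × Fin n → (Fin d → ZMod (n * M)) × Fin d)
    (hιA : ∀ y κ r t, ιA (y, κ) (r, t) =
      ((fun i => (((y i).val * n + (r i : ℕ) : ℕ) : ZMod (n * M))) + Pi.single κ ((t : ℕ) : ZMod (n * M)), κ))
    (extra : ((Fin d → ZMod (n * M)) × Fin d → W) → Prop) :
    ∀ Y : (Fin d → ZMod (n * M)) × Fin d → W,
      ((∀ y ∈ coarseSites n (fun _ : Fin d => n * M), ∀ bd ∈ treeBonds n y, Y (tcls (n * M) bd.1, bd.2) = 0) ∧ extra Y) →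
        1 / (12 * (d : ℝ) ^ 2) * ((n : ℝ) ^ (d + 1))⁻¹ * ∑ c, ‖Y c‖ ^ 2 ≤
          (n : ℝ) ^ (d - 2) * ∑ j, ‖((n : ℝ) ^ (d + 1))⁻¹ • ∑ rt, Y (ιA j rt)‖ ^ 2
            + ∑ P, ‖Y (ι P 0) + Y (ι P 1) - Y (ι P 2) - Y (ι P 3)‖ ^ 2 :=
  fun Y hY => flat_full_form_floor_torus hd n M ι hι ιA hιA Y hY.1

end Floor

/-! ## §5 Toy: `d = 2`, `n = M = 1`, `W = ℝ²`, the zero field, incidences by their lambdas -/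

/- On the one-point two-scale torus (`n = M = 1`, so `(ℤ∕1)^2`) with `W = EuclideanSpace ℝ (Fin 2)` and `B = 0`, the incidences `ι`, `ιA` given by
their defining lambdas (hypotheses fed by `rfl`) and the tree gauge trivially met, §3 elaborates and holds (junction by elaboration; no arithmetic on
`ZMod` is computed). -/
example : 1 / (12 * ((2 : ℕ) : ℝ) ^ 2) * (((1 : ℕ) : ℝ) ^ (2 + 1))⁻¹ *
      ∑ c : (Fin 2 → ZMod (1 * 1)) × Fin 2, ‖(fun _ : (Fin 2 → ZMod (1 * 1)) × Fin 2 => (0 : EuclideanSpace ℝ (Fin 2))) c‖ ^ 2 ≤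
    ((1 : ℕ) : ℝ) ^ (2 - 2) *
        ∑ j : (Fin 2 → ZMod 1) × Fin 2, ‖(((1 : ℕ) : ℝ) ^ (2 + 1))⁻¹ •
          ∑ rt : (Fin 2 → Fin 1) × Fin 1, (fun _ : (Fin 2 → ZMod (1 * 1)) × Fin 2 => (0 : EuclideanSpace ℝ (Fin 2)))
            ((fun (j : (Fin 2 → ZMod 1) × Fin 2) (rt : (Fin 2 → Fin 1) × Fin 1) =>
              ((fun i => (((j.1 i).val * 1 + (rt.1 i : ℕ) : ℕ) : ZMod (1 * 1))) + Pi.single j.2 ((rt.2 : ℕ) : ZMod (1 * 1)), j.2)) j rt)‖ ^ 2 +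
      ∑ P : (Fin 2 → ZMod (1 * 1)) × {a : Fin 2 × Fin 2 // a.1 < a.2},
        ‖(fun _ : (Fin 2 → ZMod (1 * 1)) × Fin 2 => (0 : EuclideanSpace ℝ (Fin 2)))
            ((fun (q : (Fin 2 → ZMod (1 * 1)) × {a : Fin 2 × Fin 2 // a.1 < a.2}) =>
              ![(q.1, q.2.1.1), (q.1 + Pi.single q.2.1.1 1, q.2.1.2), (q.1 + Pi.single q.2.1.2 1, q.2.1.1), (q.1, q.2.1.2)]) P 0)
          + (fun _ : (Fin 2 → ZMod (1 * 1)) × Fin 2 => (0 : EuclideanSpace ℝ (Fin 2)))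
            ((fun (q : (Fin 2 → ZMod (1 * 1)) × {a : Fin 2 × Fin 2 // a.1 < a.2}) =>
              ![(q.1, q.2.1.1), (q.1 + Pi.single q.2.1.1 1, q.2.1.2), (q.1 + Pi.single q.2.1.2 1, q.2.1.1), (q.1, q.2.1.2)]) P 1)
          - (fun _ : (Fin 2 → ZMod (1 * 1)) × Fin 2 => (0 : EuclideanSpace ℝ (Fin 2)))
            ((fun (q : (Fin 2 → ZMod (1 * 1)) × {a : Fin 2 × Fin 2 // a.1 < a.2}) =>
              ![(q.1, q.2.1.1), (q.1 + Pi.single q.2.1.1 1, q.2.1.2), (q.1 + Pi.single q.2.1.2 1, q.2.1.1), (q.1, q.2.1.2)]) P 2)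
          - (fun _ : (Fin 2 → ZMod (1 * 1)) × Fin 2 => (0 : EuclideanSpace ℝ (Fin 2)))
            ((fun (q : (Fin 2 → ZMod (1 * 1)) × {a : Fin 2 × Fin 2 // a.1 < a.2}) =>
              ![(q.1, q.2.1.1), (q.1 + Pi.single q.2.1.1 1, q.2.1.2), (q.1 + Pi.single q.2.1.2 1, q.2.1.1), (q.1, q.2.1.2)]) P 3)‖ ^ 2 := by
  haveI : NeZero (1 * 1) := ⟨by norm_num⟩
  exact flat_full_form_floor_torus (W := EuclideanSpace ℝ (Fin 2)) le_rfl 1 1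
    (fun q => ![(q.1, q.2.1.1), (q.1 + Pi.single q.2.1.1 1, q.2.1.2), (q.1 + Pi.single q.2.1.2 1, q.2.1.1), (q.1, q.2.1.2)])
    (fun _ _ => rfl)
    (fun j rt => ((fun i => (((j.1 i).val * 1 + (rt.1 i : ℕ) : ℕ) : ZMod (1 * 1))) + Pi.single j.2 ((rt.2 : ℕ) : ZMod (1 * 1)), j.2))
    (fun _ _ _ _ => rfl) (fun _ => 0) (fun _ _ _ _ => rfl)

end Summit.QuantumFields.BalabanUV.T4Continuum.NE7b.FlatFullFormFloorTorus

end
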